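import Summits.KontsevichZagierPeriods.KontsevichZagierPeriods.Theorems.LinRedNormalFormArrangementNormalFormSeparateHighCandidates

/-!
# Resultant forms of letter pairs along a good direction are bounded away from zero

(Line `janus-bands`, crux `ArrangementNormalForm`, stub `stub_separateHigh` — separation in base
dimension `≥ 3`; part `Resultant`, affine geometry in the base `ℝⁿ`.)

For two letters `L, L'` (rational affine forms `ev c`, `ev c'` on `ℝⁿ`) and a direction `v`, the
RESULTANT form `res c c' v = ∂ᵥL · L' − ∂ᵥL' · L` is the `v`-invariant affine form vanishing on the
codimension-2 flat `{L = L' = 0}`; it is the form whose non-vanishing on a closed piece is the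
wall-freeness demanded by the separation engine (`separateHigh_direction`). Two facts:
* parallel letters (`c'.1 ∈ ℚ c.1`) that are not proportional have a CONSTANT non-zero resultant
  (`res_const_of_dep`);
* independent letters: at a point `x₀` the resultant is the pairing `⟨w, v⟩` of `v` with the
  vector `w = L'(x₀) c.1 − L(x₀) c'.1` (`res_eq_pair`), it is Lipschitz in `x` with constant
  `2 Λ² W` (`abs_res_sub_le`), so a GOOD direction (`|⟨w, v⟩| ≥ η ‖w‖`, `‖w‖ ≥ θ`) keeps
  `|res| ≥ η θ / 2` on a piece of sup-diameter `δ ≤ η θ / (4 Λ² W)` around `x₀`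
  (`res_lower`, registered as `separateHigh_resultant`).
Also the grid lemma `grid_close` (two points on the same side of every grid hyperplane
`xᵢ = t h`, `|t| ≤ T`, are `h`-close) and the a-priori bound `abs_ev_le`.
-/

noncomputable section

open Finset

namespace Summit.KontsevichZagierPeriods.ArrangementNormalForm.JanusBands

namespace SepHigh

variable {n : ℕ}

/-- The value of a rational affine form `c = (c.1, c.2)` at a real base point. -/
def ev (c : (Fin n → ℚ) × ℚ) (x : Fin n → ℝ) : ℝ := ∑ i, (c.1 i : ℝ) * x i + (c.2 : ℝ)

/-- The derivative `∂ᵥ c = ∑ᵢ c.1 i · vᵢ` of a form along a rational direction. -/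
def dv (c : (Fin n → ℚ) × ℚ) (v : Fin n → ℚ) : ℚ := ∑ i, c.1 i * v i

/-- The resultant form `∂ᵥL · L' − ∂ᵥL' · L` of two letters along `v`. -/
def res (c c' : (Fin n → ℚ) × ℚ) (v : Fin n → ℚ) (x : Fin n → ℝ) : ℝ :=
  (dv c v : ℝ) * ev c' x - (dv c' v : ℝ) * ev c x

/-- The vector `w = L'(x₀) c.1 − L(x₀) c'.1` attached to a pair of letters at a point. -/
def wvec (c c' : (Fin n → ℚ) × ℚ) (x₀ : Fin n → ℝ) : Fin n → ℝ :=
  fun i => ev c' x₀ * (c.1 i : ℝ) - ev c x₀ * (c'.1 i : ℝ)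

/-- At a point, the resultant is the pairing of `v` with `wvec`. [folklore] -/
theorem res_eq_pair (c c' : (Fin n → ℚ) × ℚ) (v : Fin n → ℚ) (x₀ : Fin n → ℝ) :
    res c c' v x₀ = pair (wvec c c' x₀) v := by
  simp only [res, pair, wvec, dv, Rat.cast_sum, Rat.cast_mul, sub_mul, Finset.sum_sub_distrib,
    Finset.sum_mul]
  congr 1 <;> exact Finset.sum_congr rfl fun i _ => by ring

/-- A-priori bound for an affine form on a sup-ball. [folklore] -/
theorem abs_ev_le (c : (Fin n → ℚ) × ℚ) {R : ℝ} {x : Fin n → ℝ} (hx : ∀ i, |x i| ≤ R) :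
    |ev c x| ≤ (∑ i, |(c.1 i : ℝ)|) * R + |(c.2 : ℝ)| := by
  unfold ev
  refine (abs_add_le _ _).trans (add_le_add ?_ le_rfl)
  rw [Finset.sum_mul]
  refine (Finset.abs_sum_le_sum_abs _ _).trans (Finset.sum_le_sum fun i _ => ?_)
  rw [abs_mul]
  exact mul_le_mul_of_nonneg_left (hx i) (abs_nonneg _)

/-- The linear part of a form is Lipschitz for the sup distance. [folklore] -/
theorem abs_ev_sub_le (c : (Fin n → ℚ) × ℚ) {δ : ℝ} {x x₀ : Fin n → ℝ}
    (hδ : ∀ i, |x i - x₀ i| ≤ δ) : |ev c x - ev c x₀| ≤ (∑ i, |(c.1 i : ℝ)|) * δ := by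
  have h1 : ev c x - ev c x₀ = ∑ i, (c.1 i : ℝ) * (x i - x₀ i) := by
    simp only [ev, mul_sub, Finset.sum_sub_distrib]
    ring
  rw [h1, Finset.sum_mul]
  refine (Finset.abs_sum_le_sum_abs _ _).trans (Finset.sum_le_sum fun i _ => ?_)
  rw [abs_mul]
  exact mul_le_mul_of_nonneg_left (hδ i) (abs_nonneg _)

/-- `|∂ᵥ c| ≤ W · ∑ |c.1 i|` when `|vᵢ| ≤ W`. [folklore] -/
theorem abs_dv_le (c : (Fin n → ℚ) × ℚ) (v : Fin n → ℚ) {W : ℝ} (hW : ∀ i, |(v i : ℝ)| ≤ W) :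
    |(dv c v : ℝ)| ≤ (∑ i, |(c.1 i : ℝ)|) * W := by
  simp only [dv, Rat.cast_sum, Rat.cast_mul, Finset.sum_mul]
  refine (Finset.abs_sum_le_sum_abs _ _).trans (Finset.sum_le_sum fun i _ => ?_)
  rw [abs_mul]
  exact mul_le_mul_of_nonneg_left (hW i) (abs_nonneg _)

/-- The resultant is Lipschitz in the point: `|res x − res x₀| ≤ 2 Λ² W δ`. [folklore] -/
theorem abs_res_sub_le (c c' : (Fin n → ℚ) × ℚ) (v : Fin n → ℚ) {Λ W δ : ℝ}
    (hΛ : (∑ i, |(c.1 i : ℝ)|) ≤ Λ) (hΛ' : (∑ i, |(c'.1 i : ℝ)|) ≤ Λ) (hW : ∀ i, |(v i : ℝ)| ≤ W)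
    (hW0 : 0 ≤ W) (hδ0 : 0 ≤ δ) {x x₀ : Fin n → ℝ} (hδ : ∀ i, |x i - x₀ i| ≤ δ) :
    |res c c' v x - res c c' v x₀| ≤ 2 * Λ * Λ * W * δ := by
  have hΛ0 : 0 ≤ Λ := le_trans (Finset.sum_nonneg fun i _ => abs_nonneg _) hΛ
  have h1 : res c c' v x - res c c' v x₀ =
      (dv c v : ℝ) * (ev c' x - ev c' x₀) - (dv c' v : ℝ) * (ev c x - ev c x₀) := by
    simp only [res]
    ring
  rw [h1]
  have e1 : |(dv c v : ℝ) * (ev c' x - ev c' x₀)| ≤ Λ * W * (Λ * δ) := by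
    rw [abs_mul]
    exact mul_le_mul ((abs_dv_le c v hW).trans (mul_le_mul_of_nonneg_right hΛ hW0))
      ((abs_ev_sub_le c' hδ).trans (mul_le_mul_of_nonneg_right hΛ' hδ0)) (abs_nonneg _)
      (by positivity)
  have e2 : |(dv c' v : ℝ) * (ev c x - ev c x₀)| ≤ Λ * W * (Λ * δ) := by
    rw [abs_mul]
    exact mul_le_mul ((abs_dv_le c' v hW).trans (mul_le_mul_of_nonneg_right hΛ' hW0))
      ((abs_ev_sub_le c hδ).trans (mul_le_mul_of_nonneg_right hΛ hδ0)) (abs_nonneg _)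
      (by positivity)
  calc _ ≤ |(dv c v : ℝ) * (ev c' x - ev c' x₀)| + |(dv c' v : ℝ) * (ev c x - ev c x₀)| :=
        abs_sub _ _
    _ ≤ Λ * W * (Λ * δ) + Λ * W * (Λ * δ) := add_le_add e1 e2
    _ = 2 * Λ * Λ * W * δ := by ring

/-- **Resultant bounded away from zero along a good direction**: if `v` pairs substantially with
`w = wvec c c' x₀` (`η ‖w‖ ≤ |⟨w, v⟩|`, `θ ≤ ‖w‖`) and the piece has sup-diameter `δ` around `x₀`
with `2 Λ² W δ ≤ η θ / 2`, then `|res c c' v| ≥ η θ / 2` on the piece. [folklore] -/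
theorem res_lower (c c' : (Fin n → ℚ) × ℚ) (v : Fin n → ℚ) {Λ W δ η θ : ℝ} (x₀ : Fin n → ℝ)
    (hgood : η * ‖wvec c c' x₀‖ ≤ |pair (wvec c c' x₀) v|) (hθ : θ ≤ ‖wvec c c' x₀‖) (hη : 0 ≤ η)
    (hΛ : (∑ i, |(c.1 i : ℝ)|) ≤ Λ) (hΛ' : (∑ i, |(c'.1 i : ℝ)|) ≤ Λ) (hW : ∀ i, |(v i : ℝ)| ≤ W)
    (hW0 : 0 ≤ W) (hδ0 : 0 ≤ δ) (hδ : 2 * Λ * Λ * W * δ ≤ η * θ / 2) {x : Fin n → ℝ}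
    (hx : ∀ i, |x i - x₀ i| ≤ δ) : η * θ / 2 ≤ |res c c' v x| := by
  have h0 : η * θ ≤ |res c c' v x₀| := by
    rw [res_eq_pair]
    exact (mul_le_mul_of_nonneg_left hθ hη).trans hgood
  have h1 := abs_res_sub_le c c' v hΛ hΛ' hW hW0 hδ0 hx
  have h2 : |res c c' v x₀| - |res c c' v x - res c c' v x₀| ≤ |res c c' v x| := by
    have := abs_sub_abs_le_abs_sub (res c c' v x₀) (res c c' v x)
    rw [abs_sub_comm (res c c' v x₀)] at this
    linarith
  linarith

/-- **Parallel non-proportional letters have a constant non-zero resultant.** [folklore] -/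
theorem res_const_of_dep (c c' : (Fin n → ℚ) × ℚ) (v : Fin n → ℚ)
    (hdep : ¬ ∀ μ ν : ℚ, μ • c.1 + ν • c'.1 = 0 → μ = 0 ∧ ν = 0) (hα : dv c v ≠ 0)
    (hne : dv c' v • c ≠ dv c v • c') :
    ∃ ρ : ℝ, 0 < ρ ∧ ∀ x, ρ ≤ |res c c' v x| := by
  push Not at hdep
  obtain ⟨μ, ν, hrel, hμν⟩ := hdep
  have hc : c.1 ≠ 0 := fun h0 => hα (by simp [dv, h0])
  have hν : ν ≠ 0 := fun hν0 => by
    rw [hν0, zero_smul, add_zero] at hrel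
    rcases smul_eq_zero.1 hrel with h | h
    · exact hμν h hν0
    · exact hc h
  set r : ℚ := -μ / ν with hr
  have hc' : c'.1 = r • c.1 := by
    have h1 : c'.1 = (-ν⁻¹ * μ) • c.1 := by
      have h2 : ν • c'.1 = -(μ • c.1) := eq_neg_of_add_eq_zero_right hrel
      calc c'.1 = ν⁻¹ • (ν • c'.1) := by rw [smul_smul, inv_mul_cancel₀ hν, one_smul]
        _ = _ := by rw [h2, ← neg_smul, smul_smul, mul_neg, neg_mul]
    rw [h1, hr]
    congr 1
    ring
  have hdv : dv c' v = r * dv c v := by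
    simp only [dv, hc', Pi.smul_apply, smul_eq_mul, Finset.mul_sum]
    exact Finset.sum_congr rfl fun i _ => by ring
  have hsum : ∀ x : Fin n → ℝ, (∑ i, (((r • c.1) i : ℚ) : ℝ) * x i) =
      (r : ℝ) * ∑ i, (c.1 i : ℝ) * x i := fun x => by
    rw [Finset.mul_sum]
    exact Finset.sum_congr rfl fun i _ => by simp [mul_assoc]
  have hconst : ∀ x, res c c' v x = (dv c v : ℝ) * ((c'.2 : ℝ) - r * c.2) := fun x => by
    simp only [res, ev, hdv, hc', hsum, Rat.cast_mul]
    ring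
  have hk : c'.2 - r * c.2 ≠ 0 := fun h0 => by
    have h2 : c'.2 = r * c.2 := sub_eq_zero.1 h0
    have hcc : c' = r • c := Prod.ext hc' (by simpa using h2)
    apply hne
    rw [hdv, hcc, smul_smul, mul_comm]
  refine ⟨|(dv c v : ℝ) * ((c'.2 : ℝ) - r * c.2)|, abs_pos.2 (mul_ne_zero (by exact_mod_cast hα)
    (by exact_mod_cast hk)), fun x => by rw [hconst x]⟩

/-- **Grid lemma**: two reals in `[−R₀, R₀]` lying strictly on the same side of every grid point
`t h` (`t ∈ ℤ`, `|t| ≤ T`, `T h ≥ R₀`) are `h`-close. [folklore] -/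
theorem grid_close {h R₀ x x₀ : ℝ} (hh : 0 < h) {T : ℕ} (hx : |x| ≤ R₀) (hx₀ : |x₀| ≤ R₀)
    (hT : R₀ ≤ T * h)
    (hsign : ∀ t : ℤ, -(T : ℤ) ≤ t → t ≤ T →
      (0 < x - t * h ∧ 0 < x₀ - t * h) ∨ (x - t * h < 0 ∧ x₀ - t * h < 0)) : |x - x₀| < h := by
  -- one-sided version
  have aux : ∀ y y₀ : ℝ, |y| ≤ R₀ → |y₀| ≤ R₀ →
      (∀ t : ℤ, -(T : ℤ) ≤ t → t ≤ T →
        (0 < y - t * h ∧ 0 < y₀ - t * h) ∨ (y - t * h < 0 ∧ y₀ - t * h < 0)) →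
      ¬ y₀ + h ≤ y := by
    intro y y₀ hy hy₀ hs hle
    set t₀ : ℤ := ⌈y₀ / h⌉ with ht₀
    have h1 : y₀ ≤ t₀ * h := by
      have := Int.le_ceil (y₀ / h)
      rw [← ht₀] at this
      rwa [div_le_iff₀ hh] at this
    have h2 : (t₀ : ℝ) * h < y₀ + h := by
      have := Int.ceil_lt_add_one (y₀ / h)
      rw [← ht₀] at this
      have h3 : (t₀ : ℝ) * h < (y₀ / h + 1) * h := mul_lt_mul_of_pos_right this hh
      rwa [add_mul, div_mul_cancel₀ _ hh.ne', one_mul] at h3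
    have hlo : -(T : ℤ) ≤ t₀ := by
      have h4 : -R₀ ≤ y₀ := (abs_le.1 hy₀).1
      have h5 : (-(T : ℝ) - 1) * h < t₀ * h := by nlinarith
      have h6 : (-(T : ℝ) - 1) < t₀ := lt_of_mul_lt_mul_right h5 hh.le
      have h7 : (-(T : ℤ) - 1 : ℤ) < t₀ := by exact_mod_cast h6
      omega
    have hhi : t₀ ≤ T := by
      have h4 : y ≤ R₀ := (abs_le.1 hy).2
      have h5 : (t₀ : ℝ) * h < T * h := by linarith
      have h6 : (t₀ : ℝ) < T := lt_of_mul_lt_mul_right h5 hh.le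
      exact_mod_cast h6.le
    rcases hs t₀ hlo hhi with ⟨-, hb⟩ | ⟨ha, -⟩
    · linarith
    · linarith
  have hx' : ¬ x₀ + h ≤ x := aux x x₀ hx hx₀ hsign
  have hx₀' : ¬ x + h ≤ x₀ := aux x₀ x hx₀ hx fun t ht ht' => (hsign t ht ht').imp And.symm And.symm
  rw [abs_sub_lt_iff]
  constructor <;> linarith

end SepHigh

open SepHigh in
/-- **Resultant bounded away from zero along a good direction** (registered part of
`stub_separateHigh`; literal form of `SepHigh.res_lower`). [folklore] -/
theorem separateHigh_resultant (n : ℕ) (c c' : (Fin n → ℚ) × ℚ) (v : Fin n → ℚ) (Λ W δ η θ : ℝ) (x₀ : Fin n → ℝ) (hgood : η * ‖SepHigh.wvec c c' x₀‖ ≤ |SepHigh.pair (SepHigh.wvec c c' x₀) v|) (hθ : θ ≤ ‖SepHigh.wvec c c' x₀‖) (hη : 0 ≤ η) (hΛ : (∑ i, |(c.1 i : ℝ)|) ≤ Λ) (hΛ' : (∑ i, |(c'.1 i : ℝ)|) ≤ Λ) (hW : ∀ i, |(v i : ℝ)| ≤ W) (hW0 : 0 ≤ W) (hδ0 : 0 ≤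 δ) (hδ : 2 * Λ * Λ * W * δ ≤ η * θ / 2) (x : Fin n → ℝ) (hx : ∀ i, |x i - x₀ i| ≤ δ) : η * θ / 2 ≤ |SepHigh.res c c' v x| :=
  res_lower c c' v x₀ hgood hθ hη hΛ hΛ' hW hW0 hδ0 hδ hx

end Summit.KontsevichZagierPeriods.ArrangementNormalForm.JanusBands
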